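import Literature.NumberTheory.Automorphic.QuadraticLocalBaseChange
import Literature.NumberTheory.QuadraticForms.FiniteAdeleQuadraticNormWitness
import HarnessLib

/-!
# A family of local units `x_v ∈ (E ⊗_F F_v)^×` with prescribed norm `x_v x̄_v = t`, integral at almost every place

Topic `NumberTheory/Automorphic`; namespace `Literature.NumberTheory.Automorphic.UnitaryGroup` (home of `LocalRing E v = ∏_{w ∣ v} E_w`,
`conjLocal`, `toLocalRing`, `quadraticLocalMap`).  THEOREMS ONLY (no definition, no named fact, no instance, no `sorry`).  Cell
`hodgecm-mathlib`, FLOOR-0 P4, brick (P′1) of the line-class transport `lineClassTransport_equiv` (A-p17 (g12) `LT-roadmap.v2` ed10aabf):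
the witnesses `x_v` of HD3's local line transport (★ `LocalLineIsometryNaturalityHolds`, hypothesis `hx : a₂⁻¹δ = x x̄ a₁⁻¹δ`) chosen
SIMULTANEOUSLY at all finite places and INTEGRAL UNITS at almost all of them (so that the local transport operators fix the unramified
vector almost everywhere).

SETTING ([CasselsFrohlichANT1967] Ch. II §§10–11; [Omeara1963] §65A).  `E/F` a quadratic extension of number fields with `σ ∈ Aut(E/F)`,
`δ ∈ E`, `σ δ = −δ ≠ 0`, `δ² = d ∈ F`; `E ⊗_F F_v = ∏_{w ∣ v} E_w = LocalRing E v` with conjugation `σ ⊗ 1 = conjLocal` and structure map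
`ι_v = toLocalRing`; for `x, y ∈ F_v`, `(ι_v x + ι_v y · δ)(ι_v x − ι_v y · δ) = ι_v (x² − d y²)` (§1).

* §1 `quadraticLocalMap_mul_conjLocal` — the norm form of `Ψ_v(x, y) = ι_v x + ι_v y · δ` is `ι_v(x² − d y²)`.
* §2 **`exists_localRing_units_mul_conjLocal_eq`** — if `t ∈ F^×` is a local norm from `F_v[√d]` at every finite place (membership in
  ★ `quadraticNormSubgroup`), there is a family `x = (x_v)_v`, `x_v ∈ (∏_{w ∣ v} E_w)^×`, with `x_v · (σ ⊗ 1) x_v = ι_v t` for EVERY `v` and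
  `x_v, x_v⁻¹ ∈ ∏_{w ∣ v} 𝒪_w` for ALMOST EVERY `v` — from ★ `QuadraticForms.exists_finiteAdele_sq_sub_mul_sq_eq` (a finite-adèle solution of
  `x² − d y² = t`, integral a.e. by construction).  **`exists_localRing_units_lineDelta_eq`** — the same in the `hx` shape of the local line
  transport: from equal local norm classes of `a₁, a₂ ∈ F^×` at every finite place, units `x_v` with `a₂⁻¹ δ = x_v x̄_v a₁⁻¹ δ` in `∏ E_w`
  for every `v`, integral units a.e.

HC_CM is proved only modulo the 7 printed citations until rung 0 closes; this file proves nothing about them.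

## References
* [CasselsFrohlichANT1967] J. W. S. Cassels, A. Fröhlich (eds.), *Algebraic Number Theory* (1967), Ch. II §§10–11 (`L ⊗_K K_v ≅ ∏_{w ∣ v} L_w`).
* [Omeara1963] O. T. O'Meara, *Introduction to quadratic forms* (1963), §65A Example 65:2 (an idèle is a norm iff it is a local norm everywhere).
-/

set_option autoImplicit false

noncomputable section

open NumberField IsDedekindDomain Filter

namespace Literature.NumberTheory.Automorphic.UnitaryGroup

variable {F : Type} (E : Type) [Field F] [NumberField F] [Field E] [NumberField E] [Algebra F E]
variable (σ : E ≃ₐ[F] E) {δ : E} (hσδ : σ δ = -δ) {d : F} (hd : δ * δ = algebraMap F E d)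

/-! ## §1 The norm form of `ι_v x + ι_v y · δ` -/

include hσδ hd in
/-- `(ι_v x + ι_v y·δ) · (σ ⊗ 1)(ι_v x + ι_v y·δ) = ι_v (x² − d y²)`: `σ ⊗ 1` fixes `ι_v(F_v)` and negates `δ`.
[cite: CasselsFrohlichANT1967, Ch. II §10–§11] -/
theorem quadraticLocalMap_mul_conjLocal (v : HeightOneSpectrum (𝓞 F)) (x y : v.adicCompletion F) :
    quadraticLocalMap E v δ (x, y) * conjLocal E σ v (quadraticLocalMap E v δ (x, y)) =
      toLocalRing E v (x ^ 2 - (d : v.adicCompletion F) * y ^ 2) := by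
  have hδ2 : algebraMap E (LocalRing E v) δ * algebraMap E (LocalRing E v) δ = toLocalRing E v (d : v.adicCompletion F) := by
    rw [← map_mul, hd, toLocalRing_coe]
  rw [quadraticLocalMap_apply, map_add, map_mul, conjLocal_toLocalRing, conjLocal_toLocalRing, conjLocal_algebraMap, hσδ,
    map_neg, map_sub, map_pow, map_mul, map_pow, ← hδ2]
  ring

/-! ## §2 The family of local units with prescribed norm, integral almost everywhere -/

include hσδ hd in
/-- **local units of prescribed norm at every finite place, integral at almost every place**: for `d ≠ 0` and `t ∈ F^×` a local norm
from `F_v[√d]` at every finite `v`, there are `x_v ∈ (∏_{w ∣ v} E_w)^×` with `x_v · (σ ⊗ 1) x_v = ι_v t` for all `v`, and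
`x_v, x_v⁻¹ ∈ ∏_{w ∣ v} 𝒪_w` for almost all `v` (`x_v := ι_v x + ι_v y · δ` for a finite-adèle solution of `x² − d y² = t`).
[cite: Omeara1963, §65A Example 65:2] [cite: CasselsFrohlichANT1967, Ch. II §10–§11] -/
theorem exists_localRing_units_mul_conjLocal_eq (hδ : δ ≠ 0) (t : Fˣ)
    (h : ∀ v : HeightOneSpectrum (𝓞 F),
      Units.map (algebraMap F (v.adicCompletion F)).toMonoidHom t ∈
        QuadraticForms.quadraticNormSubgroup (v.adicCompletion F) (algebraMap F (v.adicCompletion F) d)) :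
    ∃ x : ∀ v : HeightOneSpectrum (𝓞 F), (LocalRing E v)ˣ,
      (∀ v, (x v : LocalRing E v) * conjLocal E σ v (x v) = toLocalRing E v ((t : F) : v.adicCompletion F)) ∧
      ∀ᶠ v in cofinite, ∀ w : PlacesOver E v,
        (x v : LocalRing E v) w ∈ w.1.adicCompletionIntegers E ∧
          (((x v)⁻¹ : (LocalRing E v)ˣ) : LocalRing E v) w ∈ w.1.adicCompletionIntegers E := by
  classical
  have hd0 : d ≠ 0 := fun h0 => by
    rw [h0, map_zero, mul_self_eq_zero] at hd
    exact hδ hd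
  obtain ⟨x, y, hxy⟩ := QuadraticForms.exists_finiteAdele_sq_sub_mul_sq_eq (K := F) hd0 t h
  -- the components of the finite-adèle identity
  have hv : ∀ v : HeightOneSpectrum (𝓞 F),
      (x v) ^ 2 - ((d : F) : v.adicCompletion F) * (y v) ^ 2 = ((t : F) : v.adicCompletion F) := fun v => by
    have := congrArg (fun z : FiniteAdeleRing (𝓞 F) F => z v) hxy
    exact this
  -- the local elements `X_v := ι_v x_v + ι_v y_v · δ` and their norms
  set X : ∀ v : HeightOneSpectrum (𝓞 F), LocalRing E v := fun v => quadraticLocalMap E v δ (x v, y v) with hXdef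
  have hN : ∀ v, X v * conjLocal E σ v (X v) = toLocalRing E v ((t : F) : v.adicCompletion F) := fun v => by
    show quadraticLocalMap E v δ (x v, y v) * conjLocal E σ v (quadraticLocalMap E v δ (x v, y v)) = _
    rw [quadraticLocalMap_mul_conjLocal E σ hσδ hd, hv]
  have ht0 : ∀ v : HeightOneSpectrum (𝓞 F), ((t : F) : v.adicCompletion F) ≠ 0 := fun v h0 => by
    have h1 := HeightOneSpectrum.valuedAdicCompletion_eq_valuation' v (t : F)
    rw [h0, map_zero] at h1
    exact (Valuation.ne_zero_iff _).2 t.ne_zero h1.symm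
  have hNu : ∀ v, IsUnit (toLocalRing E v ((t : F) : v.adicCompletion F)) := fun v => (IsUnit.mk0 _ (ht0 v)).map _
  have hXu : ∀ v, IsUnit (X v) := fun v => isUnit_of_mul_isUnit_left ((hN v).symm ▸ hNu v)
  -- the inverse in closed form: `X_v⁻¹ = (σ ⊗ 1) X_v · ι_v t⁻¹`
  have hconjX : ∀ v, conjLocal E σ v (X v) = quadraticLocalMap E v δ (x v, -(y v)) := fun v => by
    show conjLocal E σ v (quadraticLocalMap E v δ (x v, y v)) = _
    rw [quadraticLocalMap_apply, quadraticLocalMap_apply, map_add, map_mul, conjLocal_toLocalRing, conjLocal_toLocalRing,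
      conjLocal_algebraMap, hσδ, map_neg, map_neg]
    ring
  have hinv : ∀ v, (((hXu v).unit⁻¹ : (LocalRing E v)ˣ) : LocalRing E v) =
      conjLocal E σ v (X v) * toLocalRing E v (((t : F) : v.adicCompletion F)⁻¹) := fun v =>
    Units.inv_eq_of_mul_eq_one_right (by
      rw [IsUnit.unit_spec, ← mul_assoc, hN, ← map_mul, mul_inv_cancel₀ (ht0 v), map_one])
  refine ⟨fun v => (hXu v).unit, fun v => by rw [IsUnit.unit_spec]; exact hN v, ?_⟩
  -- integrality at almost every place
  have hx_int : ∀ᶠ v : HeightOneSpectrum (𝓞 F) in cofinite, x v ∈ v.adicCompletionIntegers F := x.2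
  have hy_int : ∀ᶠ v : HeightOneSpectrum (𝓞 F) in cofinite, y v ∈ v.adicCompletionIntegers F := y.2
  have ht_int : ∀ᶠ v : HeightOneSpectrum (𝓞 F) in cofinite, Valued.v (((t : F) : v.adicCompletion F)) = 1 := by
    have hunit : IsUnit (algebraMap F (FiniteAdeleRing (𝓞 F) F) (t : F)) := (isUnit_iff_ne_zero.2 t.ne_zero).map _
    filter_upwards [(FiniteAdeleRing.isUnit_iff.1 hunit).2] with v hv1
    exact hv1
  have hδ_int : ∀ᶠ v : HeightOneSpectrum (𝓞 F) in cofinite, ∀ w : PlacesOver E v,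
      ((δ : E) : w.1.adicCompletion E) ∈ w.1.adicCompletionIntegers E := by
    have hδE : ∀ᶠ w : HeightOneSpectrum (𝓞 E) in cofinite, ((δ : E) : w.adicCompletion E) ∈ w.adicCompletionIntegers E :=
      (algebraMap E (FiniteAdeleRing (𝓞 E) E) δ).2
    rw [Filter.eventually_cofinite] at hδE ⊢
    refine (hδE.image fun w : HeightOneSpectrum (𝓞 E) => w.under (𝓞 F)).subset ?_
    intro v hvbad
    simp only [Set.mem_setOf_eq, not_forall] at hvbad
    obtain ⟨w, hw⟩ := hvbad
    exact ⟨w.1, hw, w.2⟩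
  filter_upwards [hx_int, hy_int, ht_int, hδ_int] with v hxv hyv htv hδv
  intro w
  have hX_w : ∀ (b : v.adicCompletion F), b ∈ v.adicCompletionIntegers F →
      quadraticLocalMap E v δ (x v, b) w ∈ w.1.adicCompletionIntegers E := fun b hb => by
    rw [quadraticLocalMap_apply]
    exact add_mem (toLocalRing_mem_adicCompletionIntegers E v hxv w)
      (mul_mem (toLocalRing_mem_adicCompletionIntegers E v hb w) (hδv w))
  refine ⟨?_, ?_⟩
  · rw [IsUnit.unit_spec]
    exact hX_w (y v) hyv
  · rw [hinv, hconjX]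
    refine mul_mem (hX_w (-(y v)) (neg_mem hyv)) (toLocalRing_mem_adicCompletionIntegers E v ?_ w)
    rw [HeightOneSpectrum.mem_adicCompletionIntegers, map_inv₀, htv, inv_one]

include hσδ hd in
/-- **the same in the `hx` shape of the local line transport** (★ `LocalLineIsometryNaturalityHolds`, HD3 `lineTransportSection`):
if `a₁, a₂ ∈ F^×` have the same local norm class in `F_v^× ⧸ N(F_v[√d]^×)` at every finite place (for the CM datum `d = δ²` this is
`locF F d a₁ = locF F d a₂` of [Liu2021, Def. 4.12], read componentwise), there are units `x_v ∈ (∏_{w ∣ v} E_w)^×` with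
`a₂⁻¹ δ = x_v · (σ ⊗ 1) x_v · a₁⁻¹ δ` in `∏_{w ∣ v} E_w` for EVERY `v`, integral units at almost every `v`.
[cite: Omeara1963, §65A Example 65:2] [cite: CasselsFrohlichANT1967, Ch. II §10–§11] -/
theorem exists_localRing_units_lineDelta_eq (hδ : δ ≠ 0) (a₁ a₂ : Fˣ)
    (h : ∀ v : HeightOneSpectrum (𝓞 F),
      (Units.map (algebraMap F (v.adicCompletion F)).toMonoidHom a₁ :
          (v.adicCompletion F)ˣ ⧸ QuadraticForms.quadraticNormSubgroup (v.adicCompletion F) (algebraMap F (v.adicCompletion F) d)) =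
        (Units.map (algebraMap F (v.adicCompletion F)).toMonoidHom a₂ :
          (v.adicCompletion F)ˣ ⧸ QuadraticForms.quadraticNormSubgroup (v.adicCompletion F) (algebraMap F (v.adicCompletion F) d))) :
    ∃ x : ∀ v : HeightOneSpectrum (𝓞 F), (LocalRing E v)ˣ,
      (∀ v, algebraMap E (LocalRing E v) (algebraMap F E (↑a₂⁻¹ : F) * δ) =
        (x v : LocalRing E v) * conjLocal E σ v (x v) * algebraMap E (LocalRing E v) (algebraMap F E (↑a₁⁻¹ : F) * δ)) ∧
      ∀ᶠ v in cofinite, ∀ w : PlacesOver E v,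
        (x v : LocalRing E v) w ∈ w.1.adicCompletionIntegers E ∧
          (((x v)⁻¹ : (LocalRing E v)ˣ) : LocalRing E v) w ∈ w.1.adicCompletionIntegers E := by
  have hd0 : d ≠ 0 := fun h0 => by
    rw [h0, map_zero, mul_self_eq_zero] at hd
    exact hδ hd
  -- `t := a₂⁻¹ a₁` is a local norm everywhere
  have ht : ∀ v : HeightOneSpectrum (𝓞 F),
      Units.map (algebraMap F (v.adicCompletion F)).toMonoidHom (a₂⁻¹ * a₁) ∈
        QuadraticForms.quadraticNormSubgroup (v.adicCompletion F) (algebraMap F (v.adicCompletion F) d) := fun v => by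
    rw [map_mul, map_inv]
    exact QuotientGroup.eq.1 (h v).symm
  obtain ⟨x, hx, hint⟩ := exists_localRing_units_mul_conjLocal_eq E σ hσδ hd hδ (a₂⁻¹ * a₁) ht
  refine ⟨x, fun v => ?_, hint⟩
  have e1 : algebraMap F E (↑a₂⁻¹ : F) * δ = algebraMap F E ((a₂⁻¹ * a₁ : Fˣ) : F) * (algebraMap F E (↑a₁⁻¹ : F) * δ) := by
    rw [Units.val_mul, map_mul, ← mul_assoc, mul_assoc (algebraMap F E (↑a₂⁻¹ : F)), ← map_mul, Units.mul_inv, map_one, mul_one]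
  rw [e1, map_mul, hx, toLocalRing_coe]

end Literature.NumberTheory.Automorphic.UnitaryGroup

end
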